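import Literature.Analysis.FluidPDE.Seregin2020AncientLimit
import Literature.Analysis.FluidPDE.SereginSverakPressureDecayBalls

/-!
# Crux `SelfMixingDichotomy.SequentialTypeIExclusion` (stmt-NavierStokesRegularity-1424), line `registered`
  (reshape r3): the tangent-flow rigidity statement ⇔ Seregin's "no Type I blowups"

Lands `--supports stmt-NavierStokesRegularity-1424` the registered sub-goal
`noCentredTypeITangentFlow_of_noTypeIBlowup` of the lead's skeleton
`Cruxes/SequentialTypeIExclusion/Lines/birth.lean` (r3): the rigidity statement 3ii of reshape r2 ("a
local-energy ancient solution `(w, π)` which on every `Q(a)`, `a > 0`, is a suitable weak solution in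
Albritton–Barker's class with `w ∈ L³(Q(a))`, `A(a), C(a), D(a) ≤ K` and `C(a) ≥ κ > 0` is NOT backward-singular
at the origin") FOLLOWS from the registered open stub `stub_noTypeIBlowup` of r3, taken here as an explicit
hypothesis — Seregin's open question "does the boundedness of `g` allow blowups?" in the negative, i.e. the
statement of the named fact `Literature.Analysis.FluidPDE.Seregin2020_axisymmetricSingularPoint_typeII`
(Seregin 2020, Thm 2.1) with its two axial-symmetry hypotheses deleted: every backward singular point at the
origin of a suitable weak solution in Seregin's unit cylinder `𝒞 × ]−1, 0[` (class of Seregin 2020, Def. 1.3)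
has blow-up index `g(0) = min{limsup E, limsup A, limsup C} = ∞` (`Seregin2020.blowupIndex`).

Proof (restriction glue only): Seregin's unit cylinder lies in the parabolic ball `Q(2)`
(`parCyl_subset_parabolicCylinder`, `parabolicCylinder_mono`), so the pair restricted to it is a suitable weak
solution (`IsSuitableWeakSolutionOn.of_le`) with the global classes of Def. 1.3 inherited from
`IsSuitableWeakSolutionInBall 2 0 w π` (sliced energy on `]−1,0[ × 𝒞 ⊆ ]−4,0[ × B₂`, weak gradient
`HasWeakSpatialGradientOn.mono`, `∇w ∈ L²`, `π ∈ L^{3/2}` by monotonicity of the integrals), and its blow-up index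
is finite: `g(0) ≤ limsup_{r→0} C(0, r) ≤ K` (`Seregin2020.blowupIndex_le_limsup_cknC`). A backward-singular
origin would therefore be a Type I blowup.

Also proved (not a registered sub-goal; documents that the reshape r2 → r3 does not change the strength of
the line's open content): the CONVERSE `noTypeIBlowup_of_noCentredTypeITangentFlow` — 3ii implies "no Type I
blowups" — by the tree's blow-up extraction `Seregin2020.exists_ancientLimit` (Seregin 2014 notes Prop. 6.20;
Seregin 2020 (2.8)–(2.9), (𝒜); Albritton–Barker 2019 Lemma 2.2, Prop. 2.3), which at a Type I blowup produces
exactly a tangent flow of the kind 3ii forbids. So over the tree: 3ii ⇔ (no Type I blowups in Seregin's sense).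
-/

noncomputable section

-- the summit and its single problem share the name (D-0017 nested layout)
set_option linter.dupNamespace false

namespace Summit.NavierStokesRegularity.NavierStokesRegularity.Theorems.SequentialTypeIExclusion.Registered

open scoped ENNReal NNReal Topology
open Literature.Analysis.FluidPDE Set Filter MeasureTheory Function Metric

/-- Seregin's unit cylinder `𝒞 × ]−1, 0[` lies in the parabolic ball `Q(2) = ]−4, 0[ × B₂`
(`𝒞 ⊆ B_{√2}`, `√2 ≤ 2`). -/
theorem parCyl_zero_one_subset_parabolicCylinder_two :
    SereginSverak2009.parCyl 0 1 ⊆ parabolicCylinder 2 (0 : ℝ × EuclideanSpace ℝ (Fin 3)) := by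
  refine (parCyl_subset_parabolicCylinder 0 zero_le_one).trans ?_
  refine parabolicCylinder_mono (by positivity) ?_ _
  rw [mul_one]
  have h : Real.sqrt 2 < 2 := by
    rw [show (2 : ℝ) = Real.sqrt 4 by
      rw [show (4 : ℝ) = 2 ^ 2 by norm_num, Real.sqrt_sq (by norm_num : (0 : ℝ) ≤ 2)]]
    exact Real.sqrt_lt_sqrt (by norm_num) (by norm_num)
  exact h.le

/-- **Registered sub-goal `noCentredTypeITangentFlow_of_noTypeIBlowup` (reshape r3 of the line `registered`):
Seregin's "no Type I blowups" (the statement of `Seregin2020_axisymmetricSingularPoint_typeII` without axial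
symmetry, = the registered open stub `stub_noTypeIBlowup`, taken as hypothesis) implies the tangent-flow
rigidity statement 3ii of reshape r2.** For all `K`, `κ > 0` and every pair `(w, π)` on `ℝ × ℝ³` which on
every `Q(a)`, `a > 0`, is a suitable weak solution in Albritton–Barker's class with `w ∈ L³(Q(a))`,
`A(a), C(a), D(a) ≤ K` and `C(a) ≥ κ`: the origin is not a backward singular point of `w`. Proof: restricted
to `𝒞 × ]−1, 0[ ⊆ Q(2)` the pair is in the class of Seregin 2020 Def. 1.3 with `g(0) ≤ limsup C ≤ K < ∞`. -/
theorem noCentredTypeITangentFlow_of_noTypeIBlowup :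
    (∀ (u : ℝ → EuclideanSpace ℝ (Fin 3) → EuclideanSpace ℝ (Fin 3))
      (p : ℝ → EuclideanSpace ℝ (Fin 3) → ℝ)
      (G : ℝ → EuclideanSpace ℝ (Fin 3) → EuclideanSpace ℝ (Fin 3) →L[ℝ] EuclideanSpace ℝ (Fin 3)),
      Literature.Analysis.FluidPDE.IsSuitableWeakSolutionOn
        (Literature.Analysis.FluidPDE.SereginSverak2009.parCylOpens 0 1) 1 0 u p →
      (∃ C : NNReal, ∀ᵐ t ∂(MeasureTheory.volume.restrict (Set.Ioo (-1 : ℝ) 0)),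
        ∫⁻ x in Literature.Analysis.FluidPDE.SereginSverak2009.spaceCyl 0 1, ‖u t x‖ₑ ^ 2 ≤ C) →
      Literature.Analysis.FluidPDE.HasWeakSpatialGradientOn
        (Literature.Analysis.FluidPDE.SereginSverak2009.parCylOpens 0 1) u G →
      (∫⁻ z in Literature.Analysis.FluidPDE.SereginSverak2009.parCyl 0 1,
        ENNReal.ofReal (Literature.Analysis.FluidPDE.frobeniusNormSq (G z.1 z.2)) < ⊤) →
      (∫⁻ z in Literature.Analysis.FluidPDE.SereginSverak2009.parCyl 0 1,
        ‖p z.1 z.2‖ₑ ^ (3 / 2 : ℝ) < ⊤) →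
      Literature.Analysis.FluidPDE.IsBackwardSingularPoint u 0 →
      Literature.Analysis.FluidPDE.Seregin2020.blowupIndex 0 u G = ⊤) →
    ∀ (K : NNReal) (κ : ℝ) (w : ℝ → EuclideanSpace ℝ (Fin 3) → EuclideanSpace ℝ (Fin 3))
      (π : ℝ → EuclideanSpace ℝ (Fin 3) → ℝ), 0 < κ →
      (∀ a : ℝ, 0 < a →
        Literature.Analysis.FluidPDE.IsSuitableWeakSolutionInBall a 0 w π ∧
        MeasureTheory.MemLp (Function.uncurry w) 3 (MeasureTheory.volume.restrict
          (Literature.Analysis.FluidPDE.parabolicCylinder a (0 : ℝ × EuclideanSpace ℝ (Fin 3)))) ∧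
        Literature.Analysis.FluidPDE.cknAEss a (0 : ℝ × EuclideanSpace ℝ (Fin 3)) w ≤ K ∧
        Literature.Analysis.FluidPDE.cknC a (0 : ℝ × EuclideanSpace ℝ (Fin 3)) w ≤ K ∧
        Literature.Analysis.FluidPDE.cknD a (0 : ℝ × EuclideanSpace ℝ (Fin 3)) π ≤ K ∧
        ENNReal.ofReal κ ≤ Literature.Analysis.FluidPDE.cknC a (0 : ℝ × EuclideanSpace ℝ (Fin 3)) w) →
      ¬ Literature.Analysis.FluidPDE.IsBackwardSingularPoint w 0 := by
  intro hnoI K κ w π hκ hP hsing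
  -- the pair on the parabolic ball `Q(2) ⊇ 𝒞 × ]−1, 0[`
  obtain ⟨⟨hsw2, ⟨C, hAe⟩, ⟨G, hG, hGint⟩, hpMem⟩, -, -, -, -, -⟩ := hP 2 two_pos
  have hsub := parCyl_zero_one_subset_parabolicCylinder_two
  have hle : SereginSverak2009.parCylOpens 0 1 ≤
      parabolicCylinderOpens 2 (0 : ℝ × EuclideanSpace ℝ (Fin 3)) :=
    fun z hz => hsub hz
  -- (1) suitability and (3) the weak gradient restrict to the unit cylinder
  have hsw := hsw2.of_le hle
  have hG1 := hG.mono hle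
  -- (2) the sliced energy class on `𝒞 × ]−1, 0[`
  have hA : ∃ C : NNReal, ∀ᵐ t ∂(volume.restrict (Ioo (-1 : ℝ) 0)),
      ∫⁻ x in SereginSverak2009.spaceCyl 0 1, ‖w t x‖ₑ ^ 2 ≤ C := by
    refine ⟨C, ?_⟩
    have hI : Ioo (-1 : ℝ) 0 ⊆ Ioo ((0 : ℝ × EuclideanSpace ℝ (Fin 3)).1 - 2 ^ 2)
        (0 : ℝ × EuclideanSpace ℝ (Fin 3)).1 := by
      refine Ioo_subset_Ioo ?_ ?_ <;> simp
    have hB : SereginSverak2009.spaceCyl 0 1 ⊆ ball ((0 : ℝ × EuclideanSpace ℝ (Fin 3)).2) 2 := by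
      have h := SereginSverak2009.spaceCyl_subset_ball (0 : EuclideanSpace ℝ (Fin 3)) 1
      rw [mul_one] at h
      simpa using h
    filter_upwards [ae_restrict_of_ae_restrict_of_subset hI hAe] with t ht
    exact (lintegral_mono_set hB).trans ht
  -- (4) `∇w ∈ L²` and (5) `π ∈ L^{3/2}` of the unit cylinder
  have hE : ∫⁻ z in SereginSverak2009.parCyl 0 1, ENNReal.ofReal (frobeniusNormSq (G z.1 z.2)) < ⊤ :=
    lt_of_le_of_lt (lintegral_mono_set hsub) hGint
  have hp : ∫⁻ z in SereginSverak2009.parCyl 0 1, ‖π z.1 z.2‖ₑ ^ (3 / 2 : ℝ) < ⊤ := by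
    have h := lintegral_rpow_enorm_lt_top_of_eLpNorm_lt_top (by norm_num)
      (by simp [ENNReal.div_eq_top]) hpMem.2
    have e32 : ((3 / 2 : ℝ≥0∞)).toReal = (3 / 2 : ℝ) := by
      rw [ENNReal.toReal_div]; norm_num
    simp only [e32, uncurry] at h
    exact lt_of_le_of_lt (lintegral_mono_set hsub) h
  -- (6) the blow-up index is finite: `g(0) ≤ limsup C ≤ K`
  have hI : Seregin2020.blowupIndex 0 w G < ⊤ := by
    refine (Seregin2020.blowupIndex_le_limsup_cknC 0 w G).trans_lt
      (lt_of_le_of_lt ?_ (ENNReal.coe_lt_top (r := K)))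
    refine limsup_le_of_le (by isBoundedDefault) ?_
    filter_upwards [self_mem_nhdsWithin] with r hr
    exact (hP r hr).2.2.2.1
  -- (7) a singular origin would be a Type I blowup
  exact hI.ne (hnoI w π G hsw hA hG1 hE hp hsing)

/-- **The converse: the tangent-flow rigidity statement 3ii implies "no Type I blowups"** (so over the tree
the two are EQUIVALENT). At a backward-singular origin with `g(0) < ∞` the tree's `Seregin2020.exists_ancientLimit`
(Seregin 2014 notes Prop. 6.20; Seregin 2020, proof of Thm 2.1, (2.8)–(2.9), (𝒜); Albritton–Barker 2019 Lemma 2.2,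
Prop. 2.3) produces `K`, `κ > 0` and a tangent flow `(w, π)`, backward-singular at the origin, which on every `Q(a)`
is a suitable weak solution in Albritton–Barker's class with `w ∈ L³(Q(a))`, `A(a), C(a), D(a) ≤ K`, `C(a) ≥ κ` —
forbidden by 3ii. -/
theorem noTypeIBlowup_of_noCentredTypeITangentFlow :
    (∀ (K : NNReal) (κ : ℝ) (w : ℝ → EuclideanSpace ℝ (Fin 3) → EuclideanSpace ℝ (Fin 3))
      (π : ℝ → EuclideanSpace ℝ (Fin 3) → ℝ), 0 < κ →
      (∀ a : ℝ, 0 < a →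
        Literature.Analysis.FluidPDE.IsSuitableWeakSolutionInBall a 0 w π ∧
        MeasureTheory.MemLp (Function.uncurry w) 3 (MeasureTheory.volume.restrict
          (Literature.Analysis.FluidPDE.parabolicCylinder a (0 : ℝ × EuclideanSpace ℝ (Fin 3)))) ∧
        Literature.Analysis.FluidPDE.cknAEss a (0 : ℝ × EuclideanSpace ℝ (Fin 3)) w ≤ K ∧
        Literature.Analysis.FluidPDE.cknC a (0 : ℝ × EuclideanSpace ℝ (Fin 3)) w ≤ K ∧
        Literature.Analysis.FluidPDE.cknD a (0 : ℝ × EuclideanSpace ℝ (Fin 3)) π ≤ K ∧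
        ENNReal.ofReal κ ≤ Literature.Analysis.FluidPDE.cknC a (0 : ℝ × EuclideanSpace ℝ (Fin 3)) w) →
      ¬ Literature.Analysis.FluidPDE.IsBackwardSingularPoint w 0) →
    ∀ (u : ℝ → EuclideanSpace ℝ (Fin 3) → EuclideanSpace ℝ (Fin 3))
      (p : ℝ → EuclideanSpace ℝ (Fin 3) → ℝ)
      (G : ℝ → EuclideanSpace ℝ (Fin 3) → EuclideanSpace ℝ (Fin 3) →L[ℝ] EuclideanSpace ℝ (Fin 3)),
      Literature.Analysis.FluidPDE.IsSuitableWeakSolutionOn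
        (Literature.Analysis.FluidPDE.SereginSverak2009.parCylOpens 0 1) 1 0 u p →
      (∃ C : NNReal, ∀ᵐ t ∂(MeasureTheory.volume.restrict (Set.Ioo (-1 : ℝ) 0)),
        ∫⁻ x in Literature.Analysis.FluidPDE.SereginSverak2009.spaceCyl 0 1, ‖u t x‖ₑ ^ 2 ≤ C) →
      Literature.Analysis.FluidPDE.HasWeakSpatialGradientOn
        (Literature.Analysis.FluidPDE.SereginSverak2009.parCylOpens 0 1) u G →
      (∫⁻ z in Literature.Analysis.FluidPDE.SereginSverak2009.parCyl 0 1,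
        ENNReal.ofReal (Literature.Analysis.FluidPDE.frobeniusNormSq (G z.1 z.2)) < ⊤) →
      (∫⁻ z in Literature.Analysis.FluidPDE.SereginSverak2009.parCyl 0 1,
        ‖p z.1 z.2‖ₑ ^ (3 / 2 : ℝ) < ⊤) →
      Literature.Analysis.FluidPDE.IsBackwardSingularPoint u 0 →
      Literature.Analysis.FluidPDE.Seregin2020.blowupIndex 0 u G = ⊤ := by
  intro h3ii u p G hsw hA hG hE hp hsing
  by_contra hne
  obtain ⟨K, κ, _lam, w, π, hκ, -, -, hsingw, hall⟩ :=
    Seregin2020.exists_ancientLimit hsw hA hG hE hp hsing (lt_top_iff_ne_top.2 hne)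
  refine h3ii K κ w π hκ (fun a ha => ?_) hsingw
  obtain ⟨h1, h2, -, -, h5, h6, h7, h8⟩ := hall a ha
  exact ⟨h1, h2, h5, h6, h7, h8⟩

end Summit.NavierStokesRegularity.NavierStokesRegularity.Theorems.SequentialTypeIExclusion.Registered

end
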